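import Literature.Geometry.Lorentzian.CoordGaussianSlice
import Literature.Geometry.Lorentzian.CoordMetricCutoff
import Literature.Geometry.Lorentzian.CoordTensorCovariance
import Mathlib.Analysis.Calculus.LineDeriv.Basic
import HarnessLib

/-!
# The second-order Gaussian slice map of a coordinate hypersurface, in coordinates

Companion of `CoordGaussianSlice.lean` (the structure `IsGaussianSlice`: `g₀₀ = −1`, `g₀ᵢ = 0`,
`∂_t g₀_μ = 0` along `{0} × B`) and of `CoordTensorCovariance.lean` (`pullMetric`,
`IsCoordChangeOn`). Given

* metric components `G₀` on an open `U₀ ⊆ ℝ × F` (`IsMetricOn`),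
* the coordinate reading `P : F → ℝ × F` of a spacelike hypersurface and `N : F → ℝ × F` of its
  unit normal on an open `B₀ ⊆ F` (`IsSliceReading`: `P`, `N` are `C^∞`, `P(B₀) ⊆ U₀`, `DP`
  injective, `G₀(N, N) = −1`, `G₀(N, DP v) = 0`),

the **second-order Gaussian slice map** is
`F̂(t, y) = P y + t N y + (t²/2) A y`, `A y = −Γ_{P y}(N y, N y)` (`gaussMap`, `gaussAcc`): the
second-order Taylor polynomial in `t` of the normal geodesics `t ↦ exp_{P y}(t N y)` (Wald 1984,
§3.3, p. 42, Gaussian normal coordinates; O'Neill 1983, Ch. 3, Def. 3.24 ff.). We prove, by the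
chain rule only (no geodesic theory):

* `hasFDerivAt_gaussMap`, `fderiv_gaussMap_svec_apply` (`DF̂_{(0,y)}(s, v) = DP v + s N`),
  `fderiv_fderiv_gaussMap_tvec` (`D²F̂_{(0,y)}(e₀, (s, v)) = DN v + s A`);
* `isInvertible_fderiv_gaussMap` and `isCoordChangeOn_gaussMap` — `F̂` is a change of
  coordinates on the open set `gaussDom ⊇ {0} × B₀` (`svec_mem_gaussDom`);
* **`isGaussianSlice_pullMetric`** — the pulled-back components `G = F̂^* G₀` satisfy
  `IsGaussianSlice G B₀`: `G(e₀,e₀) = G₀(N,N) = −1`, `G(e₀,ṽ) = G₀(N, DP v) = 0` and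
  `∂_t G(e₀, ·) = 0` on the slice (the `t`-lines are geodesic to second order:
  `DG₀(N)(N,N) + 2G₀(A,N) = 0` by the Koszul formula, and
  `∂_t G(e₀, ṽ) = ½ ∂_v [G₀(N,N)] = 0`);
* `sliceMetric_pullMetric` (`h(v,w) = G₀(DP v, DP w)`, the induced metric) and
  **`sliceK_pullMetric`** (`½ ∂_t G(ṽ, w̃) = G₀(DN v + Γ(DP v, N), DP w)`, the coordinate second
  fundamental form, Wald 1984, (10.2.13); O'Neill 1983, Ch. 4, Lemma 4.4 ff.);
* `isSliceHyperbolic_pullMetric` — at slice points with positive-definite induced metric the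
  pulled-back components are slice-hyperbolic for the adapted basis (`g⁰⁰ = −1`, `gⁱʲ = hⁱʲ`).

Everything is proved; the definitions have bodies; no named facts (D-0026).

## References

* R. M. Wald, *General Relativity*, University of Chicago Press 1984, §3.3 (p. 42, Gaussian
  normal coordinates), §10.2, (10.2.9)–(10.2.13). [Wald1984]
* B. O'Neill, *Semi-Riemannian geometry with applications to relativity*, Academic Press 1983,
  Ch. 3, Prop. 3.13, Def. 3.24 ff.; Ch. 4, Lemma 4.1, Lemma 4.4 ff. [ONeill1983]
-/

noncomputable section

set_option maxSynthPendingDepth 3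

open Set Function Filter ContinuousLinearMap
open scoped Topology ContDiff

namespace Literature.Geometry.Lorentzian

namespace MetricCoord

namespace GaussSlice

variable {F : Type*} [NormedAddCommGroup F] [NormedSpace ℝ F] [FiniteDimensional ℝ F]

/-! ### The map and its first two derivatives along the slice -/

section Map

variable (G₀ : (ℝ × F) → (ℝ × F) →L[ℝ] (ℝ × F) →L[ℝ] ℝ) (P N : F → ℝ × F)

/-- **The second-order acceleration** `A y = −Γ_{P y}(N y, N y)` of the normal lines.
[cite: Wald1984, §3.3] -/
def gaussAcc (y : F) : ℝ × F := -chrAt G₀ (P y) (N y) (N y)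

/-- **The second-order Gaussian slice map** `F̂(t, y) = P y + t N y + (t²/2) A y`.
[cite: Wald1984, §3.3] -/
def gaussMap (q : ℝ × F) : ℝ × F :=
  P q.2 + q.1 • N q.2 + (q.1 ^ 2 / 2) • gaussAcc G₀ P N q.2

/-- The derivative of `F̂`, explicitly:
`DF̂_{(t,y)}(s, v) = DP v + t DN v + (t²/2) DA v + s (N y + t A y)`. [folklore] -/
def gaussMapDeriv (q : ℝ × F) : (ℝ × F) →L[ℝ] (ℝ × F) :=
  (fderiv ℝ P q.2 + q.1 • fderiv ℝ N q.2 + (q.1 ^ 2 / 2) • fderiv ℝ (gaussAcc G₀ P N) q.2).comp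
      (ContinuousLinearMap.snd ℝ ℝ F) +
    (ContinuousLinearMap.fst ℝ ℝ F).smulRight (N q.2 + q.1 • gaussAcc G₀ P N q.2)

/-- **The coordinate reading of a spacelike hypersurface with unit normal**: `P` and `N` are `C^∞`
on the open set `B₀`, `P(B₀) ⊆ U₀`, `DP` is injective, `G₀(N, N) = −1` and `G₀(N, DP v) = 0`.
[cite: Wald1984, §10.2] -/
structure IsSliceReading (U₀ : Set (ℝ × F)) (B₀ : Set F) : Prop where
  isOpen : IsOpen B₀
  contDiffOn_P : ContDiffOn ℝ ∞ P B₀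
  contDiffOn_N : ContDiffOn ℝ ∞ N B₀
  mapsTo : MapsTo P B₀ U₀
  injective : ∀ y ∈ B₀, Injective (fderiv ℝ P y)
  unit : ∀ y ∈ B₀, G₀ (P y) (N y) (N y) = -1
  normal : ∀ y ∈ B₀, ∀ v : F, G₀ (P y) (N y) (fderiv ℝ P y v) = 0

variable {G₀ P N} {U₀ : Set (ℝ × F)} {B₀ : Set F} {y : F}

omit [FiniteDimensional ℝ F] in
/-- `F̂(0, y) = P y`. [cite: Wald1984, §3.3] -/
@[simp] theorem gaussMap_svec (y : F) : gaussMap G₀ P N (svec y) = P y := by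
  simp [gaussMap]

omit [FiniteDimensional ℝ F] in
/-- `DF̂_{(0,y)}(s, v) = DP v + s N`, for the explicit derivative. [cite: Wald1984, §3.3] -/
@[simp] theorem gaussMapDeriv_svec_apply (y : F) (w : ℝ × F) :
    gaussMapDeriv G₀ P N (svec y) w = fderiv ℝ P y w.2 + w.1 • N y := by
  simp [gaussMapDeriv]

omit [FiniteDimensional ℝ F] in
/-- The `t`-line through `(0, y)`. [folklore] -/
theorem svec_add_smul_tvec (y : F) (t : ℝ) : svec y + t • (tvec : ℝ × F) = (t, y) := by
  ext <;> simp [svec, tvec]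

variable (hG₀ : IsMetricOn G₀ U₀) (hR : IsSliceReading G₀ P N U₀ B₀)
include hG₀ hR

/-- `y ↦ Γ_{P y}` is `C^∞` on `B₀`. [folklore] -/
theorem contDiffOn_chrAt_comp : ContDiffOn ℝ ∞ (fun y ↦ chrAt G₀ (P y)) B₀ :=
  hG₀.contDiffOn_chrAt.comp hR.contDiffOn_P hR.mapsTo

/-- The acceleration `A` is `C^∞` on `B₀`. [folklore] -/
theorem contDiffOn_gaussAcc : ContDiffOn ℝ ∞ (gaussAcc G₀ P N) B₀ :=
  (((contDiffOn_chrAt_comp hG₀ hR).clm_apply hR.contDiffOn_N).clm_apply hR.contDiffOn_N).neg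

omit [FiniteDimensional ℝ F] hG₀ hR in
/-- Chain rule for the three summands of `F̂`. [folklore] -/
theorem hasFDerivAt_smul_comp_snd {f : F → ℝ × F} {c : ℝ → ℝ} {c' : ℝ} {q : ℝ × F}
    (hf : DifferentiableAt ℝ f q.2) (hc : HasDerivAt c c' q.1) :
    HasFDerivAt (fun q' : ℝ × F ↦ c q'.1 • f q'.2)
      ((c q.1 • fderiv ℝ f q.2).comp (ContinuousLinearMap.snd ℝ ℝ F) +
        (ContinuousLinearMap.fst ℝ ℝ F).smulRight (c' • f q.2)) q := by
  have h1 : HasFDerivAt (fun q' : ℝ × F ↦ f q'.2) ((fderiv ℝ f q.2).comp (ContinuousLinearMap.snd ℝ ℝ F)) q :=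
    hf.hasFDerivAt.comp q hasFDerivAt_snd
  have h2 : HasFDerivAt (fun q' : ℝ × F ↦ c q'.1)
      ((ContinuousLinearMap.smulRight (1 : ℝ →L[ℝ] ℝ) c').comp (ContinuousLinearMap.fst ℝ ℝ F)) q :=
    hc.hasFDerivAt.comp q hasFDerivAt_fst
  refine (h2.smul h1).congr_fderiv (ContinuousLinearMap.ext fun w ↦ ?_)
  obtain ⟨s, v⟩ := w
  ext <;> simp [smul_smul, mul_comm]

/-- **`F̂` is differentiable with derivative `gaussMapDeriv`** at the points over `B₀`. [folklore] -/
theorem hasFDerivAt_gaussMap {q : ℝ × F} (hq : q.2 ∈ B₀) :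
    HasFDerivAt (gaussMap G₀ P N) (gaussMapDeriv G₀ P N q) q := by
  have hBn : B₀ ∈ 𝓝 q.2 := hR.isOpen.mem_nhds hq
  have hP : DifferentiableAt ℝ P q.2 := ((hR.contDiffOn_P q.2 hq).contDiffAt hBn).differentiableAt (by simp)
  have hN : DifferentiableAt ℝ N q.2 := ((hR.contDiffOn_N q.2 hq).contDiffAt hBn).differentiableAt (by simp)
  have hA : DifferentiableAt ℝ (gaussAcc G₀ P N) q.2 :=
    ((contDiffOn_gaussAcc hG₀ hR q.2 hq).contDiffAt hBn).differentiableAt (by simp)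
  have h1 : HasFDerivAt (fun q' : ℝ × F ↦ P q'.2) ((fderiv ℝ P q.2).comp (ContinuousLinearMap.snd ℝ ℝ F)) q :=
    hP.hasFDerivAt.comp q hasFDerivAt_snd
  have h2 := hasFDerivAt_smul_comp_snd (c := fun t ↦ t) (c' := 1) hN (hasDerivAt_id q.1)
  have h3 : HasFDerivAt (fun q' : ℝ × F ↦ (q'.1 ^ 2 / 2) • gaussAcc G₀ P N q'.2)
      (((q.1 ^ 2 / 2) • fderiv ℝ (gaussAcc G₀ P N) q.2).comp (ContinuousLinearMap.snd ℝ ℝ F) +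
        (ContinuousLinearMap.fst ℝ ℝ F).smulRight (q.1 • gaussAcc G₀ P N q.2)) q := by
    have hc : HasDerivAt (fun t : ℝ ↦ t ^ 2 / 2) q.1 q.1 :=
      ((hasDerivAt_pow 2 q.1).div_const 2).congr_deriv (by norm_num)
    exact hasFDerivAt_smul_comp_snd (c := fun t ↦ t ^ 2 / 2) hA hc
  have h := (h1.add h2).add h3
  have hfun : gaussMap G₀ P N = fun q' ↦ P q'.2 + q'.1 • N q'.2 + (q'.1 ^ 2 / 2) • gaussAcc G₀ P N q'.2 := rfl
  rw [hfun]
  refine h.congr_fderiv (ContinuousLinearMap.ext fun w ↦ ?_)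
  obtain ⟨s, v⟩ := w
  ext
  · simp [gaussMapDeriv]; ring
  · simp [gaussMapDeriv, smul_add]
    abel

/-- `DF̂ = gaussMapDeriv` at the points over `B₀`. [folklore] -/
theorem fderiv_gaussMap {q : ℝ × F} (hq : q.2 ∈ B₀) :
    fderiv ℝ (gaussMap G₀ P N) q = gaussMapDeriv G₀ P N q :=
  (hasFDerivAt_gaussMap hG₀ hR hq).fderiv

/-- **`DF̂_{(0,y)}(s, v) = DP_y v + s N y`.** [cite: Wald1984, §3.3] -/
theorem fderiv_gaussMap_svec_apply (hy : y ∈ B₀) (w : ℝ × F) :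
    fderiv ℝ (gaussMap G₀ P N) (svec y) w = fderiv ℝ P y w.2 + w.1 • N y := by
  rw [fderiv_gaussMap hG₀ hR (q := svec y) (by simpa [svec] using hy), gaussMapDeriv_svec_apply]

/-- `DF̂_{(0,y)} e₀ = N y`. [cite: Wald1984, §3.3] -/
theorem fderiv_gaussMap_svec_tvec (hy : y ∈ B₀) :
    fderiv ℝ (gaussMap G₀ P N) (svec y) tvec = N y := by
  rw [fderiv_gaussMap_svec_apply hG₀ hR hy]; simp

/-- `DF̂_{(0,y)} ṽ = DP_y v`. [cite: Wald1984, §3.3] -/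
theorem fderiv_gaussMap_svec_svec (hy : y ∈ B₀) (v : F) :
    fderiv ℝ (gaussMap G₀ P N) (svec y) (svec v) = fderiv ℝ P y v := by
  rw [fderiv_gaussMap_svec_apply hG₀ hR hy]; simp

/-- `F̂` is `C^∞` over `B₀`. [folklore] -/
theorem contDiffOn_gaussMap : ContDiffOn ℝ ∞ (gaussMap G₀ P N) (Prod.snd ⁻¹' B₀) := by
  have hP : ContDiffOn ℝ ∞ (fun q : ℝ × F ↦ P q.2) (Prod.snd ⁻¹' B₀) :=
    hR.contDiffOn_P.comp contDiffOn_snd fun q hq ↦ hq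
  have hN : ContDiffOn ℝ ∞ (fun q : ℝ × F ↦ N q.2) (Prod.snd ⁻¹' B₀) :=
    hR.contDiffOn_N.comp contDiffOn_snd fun q hq ↦ hq
  have hA : ContDiffOn ℝ ∞ (fun q : ℝ × F ↦ gaussAcc G₀ P N q.2) (Prod.snd ⁻¹' B₀) :=
    (contDiffOn_gaussAcc hG₀ hR).comp contDiffOn_snd fun q hq ↦ hq
  have h1 : ContDiffOn ℝ ∞ (fun q : ℝ × F ↦ q.1) (Prod.snd ⁻¹' B₀) := contDiffOn_fst
  have h2 : ContDiffOn ℝ ∞ (fun q : ℝ × F ↦ q.1 ^ 2 / 2) (Prod.snd ⁻¹' B₀) :=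
    (contDiffOn_fst.pow 2).div_const 2
  exact (hP.add (h1.smul hN)).add (h2.smul hA)

/-- The explicit derivative is differentiable over `B₀` (as a map into `L(ℝ × F)`). [folklore] -/
theorem differentiableAt_gaussMapDeriv {q : ℝ × F} (hq : q.2 ∈ B₀) :
    DifferentiableAt ℝ (gaussMapDeriv G₀ P N) q := by
  have hBn : B₀ ∈ 𝓝 q.2 := hR.isOpen.mem_nhds hq
  have hdP : DifferentiableAt ℝ (fderiv ℝ P) q.2 :=
    (((hR.contDiffOn_P.fderiv_of_isOpen hR.isOpen (m := ∞) (by simp)) q.2 hq).contDiffAt hBn).differentiableAt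
      (by simp)
  have hdN : DifferentiableAt ℝ (fderiv ℝ N) q.2 :=
    (((hR.contDiffOn_N.fderiv_of_isOpen hR.isOpen (m := ∞) (by simp)) q.2 hq).contDiffAt hBn).differentiableAt
      (by simp)
  have hdA : DifferentiableAt ℝ (fderiv ℝ (gaussAcc G₀ P N)) q.2 :=
    ((((contDiffOn_gaussAcc hG₀ hR).fderiv_of_isOpen hR.isOpen (m := ∞) (by simp)) q.2 hq).contDiffAt
      hBn).differentiableAt (by simp)
  have hN : DifferentiableAt ℝ N q.2 := ((hR.contDiffOn_N q.2 hq).contDiffAt hBn).differentiableAt (by simp)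
  have hA : DifferentiableAt ℝ (gaussAcc G₀ P N) q.2 :=
    ((contDiffOn_gaussAcc hG₀ hR q.2 hq).contDiffAt hBn).differentiableAt (by simp)
  unfold gaussMapDeriv
  refine DifferentiableAt.add ?_ ?_
  · refine DifferentiableAt.clm_comp ?_ (differentiableAt_const _)
    refine ((hdP.comp q differentiableAt_snd).add ?_).add ?_
    · exact differentiableAt_fst.smul (hdN.comp q differentiableAt_snd)
    · have h2 : DifferentiableAt ℝ (fun q' : ℝ × F ↦ q'.1 ^ 2 / 2) q := by fun_prop
      exact h2.smul (hdA.comp q differentiableAt_snd)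
  · have hv : DifferentiableAt ℝ (fun q' : ℝ × F ↦ N q'.2 + q'.1 • gaussAcc G₀ P N q'.2) q :=
      (hN.comp q differentiableAt_snd).add (differentiableAt_fst.smul (hA.comp q differentiableAt_snd))
    exact ((ContinuousLinearMap.smulRightL ℝ (ℝ × F) (ℝ × F) (ContinuousLinearMap.fst ℝ ℝ F)).differentiableAt).comp
      q hv

/-- **`D²F̂_{(0,y)}(e₀, (s, v)) = DN_y v + s A y`.** [cite: Wald1984, §3.3] -/
theorem fderiv_fderiv_gaussMap_tvec (hy : y ∈ B₀) (a : ℝ × F) :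
    fderiv ℝ (fderiv ℝ (gaussMap G₀ P N)) (svec y) tvec a = fderiv ℝ N y a.2 + a.1 • gaussAcc G₀ P N y := by
  have hy' : (svec y).2 ∈ B₀ := by simpa [svec] using hy
  -- `DF̂ = gaussMapDeriv` near `(0, y)`
  have hev : fderiv ℝ (gaussMap G₀ P N) =ᶠ[𝓝 (svec y)] gaussMapDeriv G₀ P N := by
    have hO : IsOpen (Prod.snd ⁻¹' B₀ : Set (ℝ × F)) := hR.isOpen.preimage continuous_snd
    filter_upwards [hO.mem_nhds hy'] with q hq
    exact fderiv_gaussMap hG₀ hR hq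
  rw [hev.fderiv_eq]
  -- directional derivative along `e₀` = derivative in `t`
  have hd := differentiableAt_gaussMapDeriv hG₀ hR hy'
  rw [← hd.lineDeriv_eq_fderiv, lineDeriv]
  have hline : (fun t : ℝ ↦ gaussMapDeriv G₀ P N (svec y + t • tvec)) = fun t ↦
      ((fderiv ℝ P y).comp (ContinuousLinearMap.snd ℝ ℝ F) +
          (ContinuousLinearMap.fst ℝ ℝ F).smulRight (N y)) +
        t • ((fderiv ℝ N y).comp (ContinuousLinearMap.snd ℝ ℝ F) +
          (ContinuousLinearMap.fst ℝ ℝ F).smulRight (gaussAcc G₀ P N y)) +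
        (t ^ 2 / 2) • (fderiv ℝ (gaussAcc G₀ P N) y).comp (ContinuousLinearMap.snd ℝ ℝ F) := by
    funext t
    rw [svec_add_smul_tvec]
    refine ContinuousLinearMap.ext fun w ↦ ?_
    obtain ⟨s, v⟩ := w
    ext
    · simp [gaussMapDeriv]; ring
    · simp [gaussMapDeriv, smul_add, smul_smul, mul_comm s t]
      abel
  rw [hline]
  have hderiv : HasDerivAt (fun t : ℝ ↦
      ((fderiv ℝ P y).comp (ContinuousLinearMap.snd ℝ ℝ F) +
          (ContinuousLinearMap.fst ℝ ℝ F).smulRight (N y)) +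
        t • ((fderiv ℝ N y).comp (ContinuousLinearMap.snd ℝ ℝ F) +
          (ContinuousLinearMap.fst ℝ ℝ F).smulRight (gaussAcc G₀ P N y)) +
        (t ^ 2 / 2) • (fderiv ℝ (gaussAcc G₀ P N) y).comp (ContinuousLinearMap.snd ℝ ℝ F))
      ((fderiv ℝ N y).comp (ContinuousLinearMap.snd ℝ ℝ F) +
          (ContinuousLinearMap.fst ℝ ℝ F).smulRight (gaussAcc G₀ P N y)) 0 := by
    have h1 := ((hasDerivAt_id (0 : ℝ)).smul_const ((fderiv ℝ N y).comp (ContinuousLinearMap.snd ℝ ℝ F) +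
          (ContinuousLinearMap.fst ℝ ℝ F).smulRight (gaussAcc G₀ P N y)))
    have hc : HasDerivAt (fun t : ℝ ↦ t ^ 2 / 2) 0 0 :=
      ((hasDerivAt_pow 2 (0 : ℝ)).div_const 2).congr_deriv (by norm_num)
    have h2 := hc.smul_const ((fderiv ℝ (gaussAcc G₀ P N) y).comp (ContinuousLinearMap.snd ℝ ℝ F))
    have h := ((hasDerivAt_const (0 : ℝ) ((fderiv ℝ P y).comp (ContinuousLinearMap.snd ℝ ℝ F) +
          (ContinuousLinearMap.fst ℝ ℝ F).smulRight (N y))).add h1).add h2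
    refine (h.congr_deriv ?_).congr_of_eventuallyEq (Eventually.of_forall fun t ↦ ?_)
    · simp
    · simp [smul_add]
  rw [hderiv.deriv]
  rfl

end Map

/-! ### The change of coordinates -/

section Change

variable {G₀ : (ℝ × F) → (ℝ × F) →L[ℝ] (ℝ × F) →L[ℝ] ℝ} {P N : F → ℝ × F} {U₀ : Set (ℝ × F)}
  {B₀ : Set F} {y : F}

omit [FiniteDimensional ℝ F] in
/-- The set of invertible continuous linear maps is open. [folklore] -/
theorem isOpen_setOf_isInvertible [CompleteSpace F] :
    IsOpen {L : (ℝ × F) →L[ℝ] (ℝ × F) | L.IsInvertible} := by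
  have hopen := ContinuousLinearEquiv.isOpen (𝕜 := ℝ) (E := ℝ × F) (F := ℝ × F)
  have heq : {L : (ℝ × F) →L[ℝ] (ℝ × F) | L.IsInvertible} =
      range ((↑) : ((ℝ × F) ≃L[ℝ] (ℝ × F)) → (ℝ × F) →L[ℝ] (ℝ × F)) := by
    ext L
    exact ⟨fun ⟨e, he⟩ ↦ ⟨e, he⟩, fun ⟨e, he⟩ ↦ ⟨e, he⟩⟩
  rw [heq]
  exact hopen

/-- An injective endomorphism of `ℝ × F` is invertible. [folklore] -/
theorem isInvertible_of_injective {L : (ℝ × F) →L[ℝ] (ℝ × F)} (h : Injective L) : L.IsInvertible := by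
  have hbij : Bijective L.toLinearMap := ⟨h, LinearMap.surjective_of_injective h⟩
  exact ⟨(LinearEquiv.ofBijective L.toLinearMap hbij).toContinuousLinearEquiv, by ext v <;> rfl⟩

variable (hG₀ : IsMetricOn G₀ U₀) (hR : IsSliceReading G₀ P N U₀ B₀)
include hG₀ hR

/-- **`DF̂_{(0,y)}` is injective**: if `DP v + s N = 0` then pairing with `N` gives `s = 0`
(`G₀(N, N) = −1`, `G₀(N, DP v) = 0`), and `DP` is injective. [cite: Wald1984, §10.2] -/
theorem injective_fderiv_gaussMap_svec (hy : y ∈ B₀) :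
    Injective (fderiv ℝ (gaussMap G₀ P N) (svec y)) := by
  intro w₁ w₂ h
  rw [fderiv_gaussMap_svec_apply hG₀ hR hy, fderiv_gaussMap_svec_apply hG₀ hR hy] at h
  have h1 : w₁.1 = w₂.1 := by
    have := congrArg (fun z ↦ G₀ (P y) (N y) z) h
    simp only [map_add, map_smul, hR.normal y hy, hR.unit y hy, smul_eq_mul] at this
    linarith
  have h2 : w₁.2 = w₂.2 := by
    rw [h1] at h
    exact hR.injective y hy (add_right_cancel h)
  exact Prod.ext h1 h2

/-- `DF̂_{(0,y)}` is invertible. [cite: Wald1984, §10.2] -/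
theorem isInvertible_fderiv_gaussMap_svec (hy : y ∈ B₀) :
    (fderiv ℝ (gaussMap G₀ P N) (svec y)).IsInvertible :=
  isInvertible_of_injective (injective_fderiv_gaussMap_svec hG₀ hR hy)

omit hG₀ hR in
variable (G₀ P N U₀ B₀) in
/-- **The Gaussian domain**: the points over `B₀` where `DF̂` is invertible and `F̂` lands in
`U₀`. [folklore] -/
def gaussDom : Set (ℝ × F) :=
  {q | q.2 ∈ B₀ ∧ (fderiv ℝ (gaussMap G₀ P N) q).IsInvertible ∧ gaussMap G₀ P N q ∈ U₀}

/-- The Gaussian domain is open. [folklore] -/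
theorem isOpen_gaussDom : IsOpen (gaussDom G₀ P N U₀ B₀) := by
  have hS : IsOpen (Prod.snd ⁻¹' B₀ : Set (ℝ × F)) := hR.isOpen.preimage continuous_snd
  have hc : ContinuousOn (gaussMap G₀ P N) (Prod.snd ⁻¹' B₀) := (contDiffOn_gaussMap hG₀ hR).continuousOn
  have hdc : ContinuousOn (fderiv ℝ (gaussMap G₀ P N)) (Prod.snd ⁻¹' B₀) :=
    ((contDiffOn_gaussMap hG₀ hR).fderiv_of_isOpen hS (m := ∞) (by simp)).continuousOn
  have h1 : IsOpen ((Prod.snd ⁻¹' B₀ : Set (ℝ × F)) ∩ gaussMap G₀ P N ⁻¹' U₀) :=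
    hc.isOpen_inter_preimage hS hG₀.isOpen
  have h2 : IsOpen (((Prod.snd ⁻¹' B₀ : Set (ℝ × F)) ∩ gaussMap G₀ P N ⁻¹' U₀) ∩
      fderiv ℝ (gaussMap G₀ P N) ⁻¹' {L | L.IsInvertible}) :=
    (hdc.mono inter_subset_left).isOpen_inter_preimage h1 isOpen_setOf_isInvertible
  have heq : gaussDom G₀ P N U₀ B₀ = ((Prod.snd ⁻¹' B₀ : Set (ℝ × F)) ∩ gaussMap G₀ P N ⁻¹' U₀) ∩
      fderiv ℝ (gaussMap G₀ P N) ⁻¹' {L | L.IsInvertible} := by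
    ext q
    simp only [gaussDom, mem_setOf_eq, mem_inter_iff, mem_preimage]
    tauto
  rw [heq]
  exact h2

/-- The slice points lie in the Gaussian domain. [folklore] -/
theorem svec_mem_gaussDom (hy : y ∈ B₀) : svec y ∈ gaussDom G₀ P N U₀ B₀ :=
  ⟨by simpa [svec] using hy, isInvertible_fderiv_gaussMap_svec hG₀ hR hy,
    by rw [gaussMap_svec]; exact hR.mapsTo hy⟩

/-- **`F̂` is a change of coordinates** from the Gaussian domain to `U₀`. [cite: Wald1984, §3.3] -/
theorem isCoordChangeOn_gaussMap : IsCoordChangeOn (gaussMap G₀ P N) (gaussDom G₀ P N U₀ B₀) U₀ where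
  isOpen := isOpen_gaussDom hG₀ hR
  contDiffOn := (contDiffOn_gaussMap hG₀ hR).mono fun _ hq ↦ hq.1
  mapsTo := fun _ hq ↦ hq.2.2
  isInvertible := fun _ hq ↦ hq.2.1

/-! ### The pulled-back components along the slice -/

/-- **`G(e₀, e₀) = −1` on the slice.** [cite: Wald1984, §3.3] -/
theorem pullMetric_svec_tvec_tvec (hy : y ∈ B₀) :
    pullMetric G₀ (gaussMap G₀ P N) (svec y) tvec tvec = -1 := by
  rw [pullMetric_apply, fderiv_gaussMap_svec_tvec hG₀ hR hy, gaussMap_svec, hR.unit y hy]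

/-- **`G(e₀, ṽ) = 0` on the slice.** [cite: Wald1984, §3.3] -/
theorem pullMetric_svec_tvec_svec (hy : y ∈ B₀) (v : F) :
    pullMetric G₀ (gaussMap G₀ P N) (svec y) tvec (svec v) = 0 := by
  rw [pullMetric_apply, fderiv_gaussMap_svec_tvec hG₀ hR hy, fderiv_gaussMap_svec_svec hG₀ hR hy,
    gaussMap_svec, hR.normal y hy]

/-- **The induced metric**: `G(ṽ, w̃) = G₀(DP v, DP w)` on the slice. [cite: Wald1984, (10.2.9)] -/
theorem sliceMetric_pullMetric (hy : y ∈ B₀) (v w : F) :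
    sliceMetric (pullMetric G₀ (gaussMap G₀ P N)) y v w = G₀ (P y) (fderiv ℝ P y v) (fderiv ℝ P y w) := by
  rw [sliceMetric_apply, pullMetric_apply, fderiv_gaussMap_svec_svec hG₀ hR hy,
    fderiv_gaussMap_svec_svec hG₀ hR hy, gaussMap_svec]

omit [FiniteDimensional ℝ F] in
/-- The derivative of the normalisation `y ↦ G₀(P y)(N y, N y) = −1` vanishes:
`DG₀(DP v)(N, N) + 2 G₀(N, DN v) = 0`. [cite: Wald1984, §10.2] -/
theorem fderiv_unit (hy : y ∈ B₀) (v : F) :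
    fderiv ℝ G₀ (P y) (fderiv ℝ P y v) (N y) (N y) + 2 * G₀ (P y) (N y) (fderiv ℝ N y v) = 0 := by
  have hBn : B₀ ∈ 𝓝 y := hR.isOpen.mem_nhds hy
  have hP : DifferentiableAt ℝ P y := ((hR.contDiffOn_P y hy).contDiffAt hBn).differentiableAt (by simp)
  have hN : DifferentiableAt ℝ N y := ((hR.contDiffOn_N y hy).contDiffAt hBn).differentiableAt (by simp)
  have hc : HasFDerivAt (fun y' ↦ G₀ (P y')) ((fderiv ℝ G₀ (P y)).comp (fderiv ℝ P y)) y :=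
    (hG₀.differentiableAt (hR.mapsTo hy)).hasFDerivAt.comp y hP.hasFDerivAt
  have h := (hc.clm_apply hN.hasFDerivAt).clm_apply hN.hasFDerivAt
  have hzero : fderiv ℝ (fun y' ↦ G₀ (P y') (N y') (N y')) y = 0 :=
    fderiv_eq_zero_of_eqOn_const hR.isOpen (fun y' hy' ↦ hR.unit y' hy') hy
  have h' := congrArg (fun L : F →L[ℝ] ℝ ↦ L v) (h.fderiv.symm.trans hzero)
  simp only [_root_.add_apply, ContinuousLinearMap.comp_apply, ContinuousLinearMap.flip_apply,
    _root_.zero_apply] at h'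
  rw [hG₀.symm _ (hR.mapsTo hy) (fderiv ℝ N y v) (N y)] at h'
  linarith

omit [FiniteDimensional ℝ F] in
/-- The derivative of the orthogonality `y ↦ G₀(P y)(N y, DP_y w) = 0`:
`DG₀(DP v)(N, DP w) + G₀(DN v, DP w) + G₀(N, D²P(v, w)) = 0`. [cite: Wald1984, §10.2] -/
theorem fderiv_normal (hy : y ∈ B₀) (v w : F) :
    fderiv ℝ G₀ (P y) (fderiv ℝ P y v) (N y) (fderiv ℝ P y w) + G₀ (P y) (fderiv ℝ N y v) (fderiv ℝ P y w) +
      G₀ (P y) (N y) (fderiv ℝ (fderiv ℝ P) y v w) = 0 := by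
  have hBn : B₀ ∈ 𝓝 y := hR.isOpen.mem_nhds hy
  have hP : DifferentiableAt ℝ P y := ((hR.contDiffOn_P y hy).contDiffAt hBn).differentiableAt (by simp)
  have hN : DifferentiableAt ℝ N y := ((hR.contDiffOn_N y hy).contDiffAt hBn).differentiableAt (by simp)
  have hdP : DifferentiableAt ℝ (fderiv ℝ P) y :=
    (((hR.contDiffOn_P.fderiv_of_isOpen hR.isOpen (m := ∞) (by simp)) y hy).contDiffAt hBn).differentiableAt
      (by simp)
  have hc : HasFDerivAt (fun y' ↦ G₀ (P y')) ((fderiv ℝ G₀ (P y)).comp (fderiv ℝ P y)) y :=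
    (hG₀.differentiableAt (hR.mapsTo hy)).hasFDerivAt.comp y hP.hasFDerivAt
  have hw : HasFDerivAt (fun y' ↦ fderiv ℝ P y' w) ((fderiv ℝ (fderiv ℝ P) y).flip w) y :=
    hasFDerivAt_clm_apply_const hdP.hasFDerivAt w
  have h := (hc.clm_apply hN.hasFDerivAt).clm_apply hw
  have hzero : fderiv ℝ (fun y' ↦ G₀ (P y') (N y') (fderiv ℝ P y' w)) y = 0 :=
    fderiv_eq_zero_of_eqOn_const hR.isOpen (fun y' hy' ↦ hR.normal y' hy' w) hy
  have h' := congrArg (fun L : F →L[ℝ] ℝ ↦ L v) (h.fderiv.symm.trans hzero)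
  simp only [_root_.add_apply, ContinuousLinearMap.comp_apply, ContinuousLinearMap.flip_apply,
    _root_.zero_apply] at h'
  linarith

omit [FiniteDimensional ℝ F] in
/-- `G₀(A, X) = −DG₀(N)(N, X) + ½ DG₀(X)(N, N)` (Koszul formula for `A = −Γ(N, N)`).
[cite: ONeill1983, Ch. 3, Prop. 3.13] -/
theorem apply_gaussAcc (hy : y ∈ B₀) (X : ℝ × F) :
    G₀ (P y) (gaussAcc G₀ P N y) X =
      -fderiv ℝ G₀ (P y) (N y) (N y) X + 2⁻¹ * fderiv ℝ G₀ (P y) X (N y) (N y) := by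
  have hx := hR.mapsTo hy
  rw [gaussAcc, map_neg, _root_.neg_apply, apply_chrAt (hG₀.isInvertible _ hx),
    koszulCLM_apply, hG₀.fderiv_symm hx (N y) X (N y)]
  ring

/-- **The `t`-lines are geodesic to second order**: `∂_t G(e₀, ·) = 0` on the slice.
[cite: Wald1984, §3.3] -/
theorem fderiv_pullMetric_svec_tvec_tvec (hy : y ∈ B₀) (w : ℝ × F) :
    fderiv ℝ (pullMetric G₀ (gaussMap G₀ P N)) (svec y) tvec tvec w = 0 := by
  have hψ := isCoordChangeOn_gaussMap hG₀ hR
  have hq := svec_mem_gaussDom hG₀ hR hy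
  rw [hG₀.fderiv_pullMetric hψ hq, fderiv_fderiv_gaussMap_tvec hG₀ hR hy,
    fderiv_fderiv_gaussMap_tvec hG₀ hR hy, fderiv_gaussMap_svec_tvec hG₀ hR hy,
    fderiv_gaussMap_svec_apply hG₀ hR hy, gaussMap_svec]
  have hx := hR.mapsTo hy
  have h1 := apply_gaussAcc hG₀ hR hy (fderiv ℝ P y w.2 + w.1 • N y)
  have h2 := apply_gaussAcc hG₀ hR hy (N y)
  have h3 := fderiv_unit hG₀ hR hy w.2
  simp only [map_zero, zero_add, one_smul, map_add, map_smul, _root_.add_apply,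
    FunLike.coe_smul, Pi.smul_apply, smul_eq_mul] at h1 h2 h3 ⊢
  rw [hG₀.symm _ hx (N y) (gaussAcc G₀ P N y)]
  linear_combination h1 + w.1 * h2 + (1 / 2 : ℝ) * h3

/-- **The pulled-back components form a Gaussian slice** on `B₀`. [cite: Wald1984, §3.3] -/
theorem isGaussianSlice_pullMetric : IsGaussianSlice (pullMetric G₀ (gaussMap G₀ P N)) B₀ where
  g00 := fun _ hy ↦ pullMetric_svec_tvec_tvec hG₀ hR hy
  g0x := fun _ hy v ↦ pullMetric_svec_tvec_svec hG₀ hR hy v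
  dg0 := fun _ hy w ↦ fderiv_pullMetric_svec_tvec_tvec hG₀ hR hy w

/-- **The second fundamental form in the Gaussian chart**:
`½ ∂_t G(ṽ, w̃) = G₀(DN v + Γ_{P y}(DP v, N), DP w)` on the slice. [cite: Wald1984, (10.2.13)] -/
theorem sliceK_pullMetric (hy : y ∈ B₀) (v w : F) :
    sliceK (pullMetric G₀ (gaussMap G₀ P N)) y v w =
      G₀ (P y) (fderiv ℝ N y v + chrAt G₀ (P y) (fderiv ℝ P y v) (N y)) (fderiv ℝ P y w) := by
  have hψ := isCoordChangeOn_gaussMap hG₀ hR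
  have hq := svec_mem_gaussDom hG₀ hR hy
  have hx := hR.mapsTo hy
  rw [sliceK_apply, hG₀.fderiv_pullMetric hψ hq, fderiv_fderiv_gaussMap_tvec hG₀ hR hy,
    fderiv_fderiv_gaussMap_tvec hG₀ hR hy, fderiv_gaussMap_svec_tvec hG₀ hR hy,
    fderiv_gaussMap_svec_svec hG₀ hR hy, fderiv_gaussMap_svec_svec hG₀ hR hy, gaussMap_svec]
  have hr : G₀ (P y) (fderiv ℝ N y v + chrAt G₀ (P y) (fderiv ℝ P y v) (N y)) (fderiv ℝ P y w) =
      G₀ (P y) (fderiv ℝ N y v) (fderiv ℝ P y w) +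
        2⁻¹ * (fderiv ℝ G₀ (P y) (fderiv ℝ P y v) (N y) (fderiv ℝ P y w) +
          fderiv ℝ G₀ (P y) (N y) (fderiv ℝ P y w) (fderiv ℝ P y v) -
          fderiv ℝ G₀ (P y) (fderiv ℝ P y w) (fderiv ℝ P y v) (N y)) := by
    rw [map_add, _root_.add_apply, apply_chrAt (hG₀.isInvertible _ hx), koszulCLM_apply]
  rw [hr]
  simp only [zero_smul, add_zero]
  have h1 := fderiv_normal hG₀ hR hy v w
  have h2 := fderiv_normal hG₀ hR hy w v
  have hsymm2 : fderiv ℝ (fderiv ℝ P) y w v = fderiv ℝ (fderiv ℝ P) y v w :=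
    ((hR.contDiffOn_P y hy).contDiffAt (hR.isOpen.mem_nhds hy)).isSymmSndFDerivAt two_le_infty w v
  rw [hsymm2, hG₀.fderiv_symm hx (fderiv ℝ P y w) (N y) (fderiv ℝ P y v)] at h2
  rw [hG₀.symm _ hx (fderiv ℝ P y v) (fderiv ℝ N y w),
    hG₀.fderiv_symm hx (N y) (fderiv ℝ P y w) (fderiv ℝ P y v)]
  linear_combination (1 / 2 : ℝ) * h2 - (1 / 2 : ℝ) * h1

end Change

/-! ### Slice-hyperbolicity of Gaussian slices with Riemannian induced metric -/

section Hyperbolic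

variable {ι : Type*} [Fintype ι] (b₀ : Module.Basis ι ℝ F)

/-- **The inverse of a positive-definite symmetric form is positive definite**: the matrix
`(hʲᵏ) = (bʲ(♯bᵏ))` satisfies `Σ hʲᵏ ξⱼ ξₖ = h(♯α, ♯α) > 0` for `α = Σ ξⱼ bʲ ≠ 0`.
[cite: ONeill1983, Ch. 3, p. 60] -/
theorem mIsPosDef_ginv {H : F → F →L[ℝ] F →L[ℝ] ℝ} {y : F} (hinv : (H y).IsInvertible)
    (hpos : ∀ v : F, v ≠ 0 → 0 < H y v v) :
    MIsPosDef (fun j k ↦ ginv H b₀ y j k) := by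
  classical
  intro ξ hξ
  set α : F →L[ℝ] ℝ := ∑ j, ξ j • coordCLM b₀ j with hα
  have hαb : ∀ i, α (b₀ i) = ξ i := fun i ↦ by
    simp [hα, coordCLM_apply, Module.Basis.coord_apply, Module.Basis.repr_self,
      Finsupp.single_apply]
  have hα0 : α ≠ 0 := by
    intro h
    apply hξ
    funext i
    rw [← hαb i, h]
    rfl
  -- `♯α ≠ 0`
  have hsharp : sharpAt H y α ≠ 0 := by
    intro h
    apply hα0
    rw [← apply_sharpAt hinv α, h, map_zero]
  -- the quadratic form is `α(♯α) = H(♯α, ♯α)`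
  have hq : mqf (fun j k ↦ ginv H b₀ y j k) ξ = α (sharpAt H y α) := by
    have hlin : sharpAt H y α = ∑ j, ξ j • sharpAt H y (coordCLM b₀ j) := by
      simp [hα, map_sum, map_smul]
    rw [hlin, map_sum]
    simp only [map_smul, smul_eq_mul, hα, FunLike.coe_sum, Finset.sum_apply,
      FunLike.coe_smul, Pi.smul_apply, coordCLM_apply, mqf, ginv]
    rw [Finset.sum_comm]
    refine Finset.sum_congr rfl fun k _ ↦ ?_
    rw [Finset.mul_sum]
    refine Finset.sum_congr rfl fun j _ ↦ ?_
    ring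
  rw [hq, ← apply_sharpAt_apply hinv α (sharpAt H y α)]
  exact hpos _ hsharp

omit [FiniteDimensional ℝ F] in
/-- **A uniform lower bound for a positive-definite matrix**: `λ Σ ξᵢ² ≤ Σ Nʲᵏ ξⱼ ξₖ` for some
`λ > 0` (minimum over the unit sphere). [folklore] -/
theorem exists_pos_mul_sum_sq_le_mqf {N : ι → ι → ℝ} (hN : MIsPosDef N) :
    ∃ lam : ℝ, 0 < lam ∧ ∀ ξ : ι → ℝ, lam * ∑ i, ξ i ^ 2 ≤ mqf N ξ := by
  rcases isEmpty_or_nonempty ι with hι | hι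
  · refine ⟨1, one_pos, fun ξ ↦ ?_⟩
    simp [mqf]
  have hS : IsCompact (Metric.sphere (0 : ι → ℝ) 1) := isCompact_sphere 0 1
  obtain ⟨i⟩ := hι
  have hne : (Metric.sphere (0 : ι → ℝ) 1).Nonempty := by
    classical
    refine ⟨Pi.single i 1, ?_⟩
    rw [mem_sphere_zero_iff_norm, Pi.norm_single, norm_one]
  obtain ⟨ξ₀, hξ₀S, hmin⟩ := hS.exists_isMinOn hne (continuous_mqf N).continuousOn
  have hξ₀ : ξ₀ ≠ 0 := by
    intro h
    rw [h, mem_sphere_zero_iff_norm, norm_zero] at hξ₀S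
    exact zero_ne_one hξ₀S
  set lam₀ := mqf N ξ₀ with hlam₀
  have hlam0 : 0 < lam₀ := hN ξ₀ hξ₀
  haveI : Nonempty ι := ⟨i⟩
  have hcard : (0 : ℝ) < Fintype.card ι := by exact_mod_cast Fintype.card_pos
  refine ⟨lam₀ / Fintype.card ι, div_pos hlam0 hcard, fun ξ ↦ ?_⟩
  -- `Σ ξᵢ² ≤ #ι ‖ξ‖²`
  have hsum : ∑ i, ξ i ^ 2 ≤ Fintype.card ι * ‖ξ‖ ^ 2 := by
    have h1 : ∀ i, ξ i ^ 2 ≤ ‖ξ‖ ^ 2 := fun i ↦ by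
      rw [← sq_abs, ← Real.norm_eq_abs]
      exact pow_le_pow_left₀ (norm_nonneg _) (norm_le_pi_norm ξ i) 2
    calc ∑ i, ξ i ^ 2 ≤ ∑ _i : ι, ‖ξ‖ ^ 2 := Finset.sum_le_sum fun i _ ↦ h1 i
      _ = Fintype.card ι * ‖ξ‖ ^ 2 := by simp
  by_cases hξ : ξ = 0
  · subst hξ
    simp [mqf]
  have hnξ : 0 < ‖ξ‖ := norm_pos_iff.2 hξ
  set η : ι → ℝ := ‖ξ‖⁻¹ • ξ with hη
  have hηS : η ∈ Metric.sphere (0 : ι → ℝ) 1 := by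
    rw [mem_sphere_zero_iff_norm, hη, norm_smul, norm_inv, norm_norm, inv_mul_cancel₀ hnξ.ne']
  have hξη : ξ = ‖ξ‖ • η := by
    rw [hη, smul_smul, mul_inv_cancel₀ hnξ.ne', one_smul]
  have h1 : lam₀ ≤ mqf N η := hmin hηS
  have h2 : mqf N ξ = ‖ξ‖ ^ 2 * mqf N η := by
    conv_lhs => rw [hξη]
    exact mqf_smul N ‖ξ‖ η
  rw [h2]
  calc lam₀ / Fintype.card ι * ∑ i, ξ i ^ 2
      ≤ lam₀ / Fintype.card ι * (Fintype.card ι * ‖ξ‖ ^ 2) :=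
        mul_le_mul_of_nonneg_left hsum (div_pos hlam0 hcard).le
    _ = ‖ξ‖ ^ 2 * lam₀ := by field_simp
    _ ≤ ‖ξ‖ ^ 2 * mqf N η := mul_le_mul_of_nonneg_left h1 (sq_nonneg _)

variable {G : (ℝ × F) → (ℝ × F) →L[ℝ] (ℝ × F) →L[ℝ] ℝ} {T : Set (ℝ × F)} {B : Set F} {y : F}

/-- **Gaussian slices with Riemannian induced metric are slice-hyperbolic** for the adapted
basis: `g⁰⁰ = −1 < 0` and the spatial symbol is `(hⁱʲ)`, positive definite.
[cite: HawkingEllis1973CUP, §7.4] -/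
theorem isSliceHyperbolic_of_isGaussianSlice (hG : IsMetricOn G T) (hS : IsGaussianSlice G B)
    (hB : IsOpen B) (hBT : ∀ y ∈ B, svec y ∈ T) (hy : y ∈ B)
    (hpos : ∀ v : F, v ≠ 0 → 0 < sliceMetric G y v v) :
    IsSliceHyperbolic (sliceBasis b₀) (G (svec y)) where
  isInvertible := hG.isInvertible _ (hBT y hy)
  g00_neg := by
    rw [← ginv_eq_ginvOf, ginv_none_none b₀ hG hS hBT hy]
    norm_num
  posDef := by
    have hh := isMetricOn_sliceMetric hG hS hB hBT
    have heq : sliceQOf (sliceBasis b₀) (G (svec y)) = fun j k ↦ ginv (sliceMetric G) b₀ y j k := by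
      funext j k
      rw [sliceQOf, ← ginv_eq_ginvOf, ← ginv_eq_ginvOf, ← ginv_eq_ginvOf, ginv_some_some b₀ hG hS hB hBT hy,
        ginv_none_some b₀ hG hS hB hBT hy]
      simp
    rw [heq]
    exact mIsPosDef_ginv b₀ (hh.isInvertible y hy) hpos

end Hyperbolic

end GaussSlice

end MetricCoord

end Literature.Geometry.Lorentzian

end
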